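import Summits.NavierStokesRegularity.NavierStokesRegularity.Theorems.QuantisedSymmetryPolyhedralDssProfileExistsStubGaussianEnstrophyIdentityHelpers
import Literature.Analysis.FluidPDE.WholeSpaceIBPIntegrable
import Literature.Analysis.FluidPDE.VectorCalculusProofs
import Literature.Analysis.FluidPDE.KinematicApexWitness
import HarnessLib

/-!
# The kinematic weighted div–curl identity — crux stmt-NavierStokesRegularity-1404
  (`QuantisedSymmetry.PolyhedralDssProfileExists`), line polyhedral_cell, stub
  stub_weightedDivCurl (N22)

Registered stub `stub_weightedDivCurl` (`--supports stmt-NavierStokesRegularity-1404`).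
For a divergence-free `C²` field `U : ℝ³ → ℝ³` with polynomial bounds on `U` and `DU`, and the
Gaussian weight `w₀ = e^{−|y|²/4}` (the tree's `gaussProfile (−1/4)`):

  `∫ w₀ |DU|²_F − ∫ w₀ |curl U|² = ¼ ∫ w₀ (y·U)² − ½ ∫ w₀ |U|²`

(the identity converting the weighted enstrophy of the Gaussian enstrophy identity N10 into
the weighted Dirichlet form).

Proof sketch.
* (a) Pointwise linear algebra: `|DU|²_F − |curl U|² = tr(DU ∘ DU)` from
  `|L − Lᵀ|²_F = 2(|L|²_F − tr(L L))` (`frobeniusNormSq_sub_adjoint`) and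
  `|curl U|² = ½ |DU − DUᵀ|²_F` (`norm_curl_sq_eq_frobeniusNormSq_spin_holds`); and
  `tr(DU ∘ DU) = div((U·∇)U)` for `div U = 0`, `U ∈ C²` (`divergence_convect_self_eq`; this is
  where `∂ᵢ(div U) = 0` and the symmetry of second derivatives enter).
* (b) Two whole-space integrations by parts in `L¹` form
  (`integral_mul_divergence_add_eq_zero_of_integrable`: `∫ θ div u + ∫ ⟪u, ∇θ⟫ = 0`), with
  `∇w₀ = −½ w₀ y`: first `θ = w₀`, `u = (U·∇)U`, giving
  `∫ w₀ div((U·∇)U) = ½ ∫ w₀ ⟪y, DU[U]⟫`; then `θ = y·U`, `u = w₀ U`, where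
  `div(w₀ U) = −½ w₀ (y·U)` and `⟪w₀ U, ∇(y·U)⟫ = w₀ (|U|² + ⟪y, DU[U]⟫)`, giving
  `∫ w₀ ⟪y, DU[U]⟫ = ½ ∫ w₀ (y·U)² − ∫ w₀ |U|²`.
* Every integrand is continuous and `O((1 + |y|)^{4(N+1)} w₀)`, hence integrable
  (`gaussEnstrophy_integrable_of_le`,
  `PineauVicol2026.integrable_one_add_norm_pow_mul_exp_neg_mul_sq`).
-/

noncomputable section

-- the summit namespace `…NavierStokesRegularity.NavierStokesRegularity…` is the tree convention
set_option linter.dupNamespace false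

namespace Summit.NavierStokesRegularity.NavierStokesRegularity.Theorems.PolyhedralDssProfileExists.PolyhedralCell

open MeasureTheory Set Function Filter Topology
open Literature.Analysis Literature.Analysis.FluidPDE
open scoped InnerProductSpace RealInnerProductSpace

variable {U : EuclideanSpace ℝ (Fin 3) → EuclideanSpace ℝ (Fin 3)} {K : ℝ} {N : ℕ}

/-! ### Pointwise: `|DU|²_F − |curl U|² = div((U·∇)U)` -/

/-- **The pointwise div–curl identity**: for a divergence-free `C²` field on `ℝ³`,
`|DU(y)|²_F − |curl U(y)|² = tr(DU(y) ∘ DU(y)) = div((U·∇)U)(y)`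
(`|curl U|² = ½|DU − DUᵀ|²_F = |DU|²_F − tr(DU DU)` and `div((U·∇)U) = tr((DU)²)` when
`div U = 0`). [folklore] -/
theorem weightedDivCurl_pointwise (hU : ContDiff ℝ 2 U) (hdiv : VectorCalculus.IsDivFree U)
    (y : EuclideanSpace ℝ (Fin 3)) :
    frobeniusNormSq (fderiv ℝ U y) - ‖curl U y‖ ^ 2 =
      VectorCalculus.divergence (convect U U) y := by
  have hd : DifferentiableAt ℝ U y := (hU.differentiable (by norm_num)) y
  have hc : ‖curl U y‖ ^ 2 = 2⁻¹ * frobeniusNormSq (spin U y) :=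
    norm_curl_sq_eq_frobeniusNormSq_spin_holds U y hd
  have hs : spin U y = fderiv ℝ U y - ContinuousLinearMap.adjoint (fderiv ℝ U y) := rfl
  rw [divergence_convect_self_eq hU hdiv y, hc, hs, frobeniusNormSq_sub_adjoint]
  ring

/-! ### Calculus with the Gaussian weight `w₀ = gaussProfile (−1/4)` and with `θ = y·U` -/

/-- `⟪v, ∇w₀(y)⟫ = −½ w₀(y) ⟪y, v⟫` (`∇w₀ = −½ w₀ y`). [folklore] -/
theorem weightedDivCurl_inner_gradient_weight (y v : EuclideanSpace ℝ (Fin 3)) :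
    ⟪v, gradient (gaussProfile (-(1 / 4 : ℝ))) y⟫ =
      -(1 / 2 : ℝ) * (gaussProfile (-(1 / 4 : ℝ)) y * ⟪y, v⟫) := by
  rw [real_inner_comm, gradient, InnerProductSpace.toDual_symm_apply, fderiv_gaussProfile_apply]
  ring

/-- `div(w₀ U)(y) = −½ w₀(y) ⟪y, U(y)⟫` for a field differentiable at `y` with `div U(y) = 0`
(`div(w₀ U) = w₀ div U + ⟪U, ∇w₀⟫`). [folklore] -/
theorem weightedDivCurl_divergence_weight_smul {y : EuclideanSpace ℝ (Fin 3)}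
    (hU : DifferentiableAt ℝ U y) (hdiv : VectorCalculus.divergence U y = 0) :
    VectorCalculus.divergence (fun z => gaussProfile (-(1 / 4 : ℝ)) z • U z) y =
      -(1 / 2 : ℝ) * (gaussProfile (-(1 / 4 : ℝ)) y * ⟪y, U y⟫) := by
  have hw : DifferentiableAt ℝ (gaussProfile (E := EuclideanSpace ℝ (Fin 3)) (-(1 / 4 : ℝ))) y :=
    ((contDiff_gaussProfile (E := EuclideanSpace ℝ (Fin 3)) (-(1 / 4 : ℝ)) (n := 1)).differentiable
      one_ne_zero) y
  rw [divergence_smul_apply hw hU, hdiv, mul_zero, zero_add,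
    weightedDivCurl_inner_gradient_weight]

/-- `⟪w₀ U, ∇(y·U)⟫ = w₀ |U|² + w₀ ⟪y, DU[U]⟫` at points of differentiability
(`D(y·U)(y) v = ⟪v, U(y)⟫ + ⟪y, DU(y) v⟫`). [folklore] -/
theorem weightedDivCurl_inner_gradient_theta {y : EuclideanSpace ℝ (Fin 3)}
    (hU : DifferentiableAt ℝ U y) :
    ⟪gaussProfile (-(1 / 4 : ℝ)) y • U y, gradient (fun z => ⟪z, U z⟫) y⟫ =
      gaussProfile (-(1 / 4 : ℝ)) y * ‖U y‖ ^ 2 +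
        gaussProfile (-(1 / 4 : ℝ)) y * ⟪y, fderiv ℝ U y (U y)⟫ := by
  rw [real_inner_comm, gradient, InnerProductSpace.toDual_symm_apply, map_smul, smul_eq_mul,
    fderiv_inner_apply ℝ differentiableAt_fun_id hU, fderiv_fun_id, ContinuousLinearMap.coe_id',
    id_eq, real_inner_self_eq_norm_sq]
  ring

/-! ### Integrability: every integrand is `O((1 + |y|)^{4(N+1)} w₀)` -/

/-- A continuous vector field on `ℝ³` dominated by `C (1 + |y|)ᴹ e^{−|y|²/4}` is integrable
(`PineauVicol2026.integrable_one_add_norm_pow_mul_exp_neg_mul_sq`; vector-valued companion of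
`gaussEnstrophy_integrable_of_le`). [folklore] -/
theorem weightedDivCurl_integrable_vec_of_le
    {F : EuclideanSpace ℝ (Fin 3) → EuclideanSpace ℝ (Fin 3)} (hF : Continuous F) {C : ℝ} {M : ℕ}
    (hb : ∀ y, ‖F y‖ ≤ C * ((1 + ‖y‖) ^ M * gaussProfile (-(1 / 4 : ℝ)) y)) : Integrable F := by
  have hg := (PineauVicol2026.integrable_one_add_norm_pow_mul_exp_neg_mul_sq
    (E := EuclideanSpace ℝ (Fin 3)) (c := 1 / 4) (by norm_num) M).const_mul C
  refine hg.mono' hF.aestronglyMeasurable (Eventually.of_forall fun y => ?_)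
  have e : Real.exp (-(1 / 4) * ‖y‖ ^ 2) = gaussProfile (-(1 / 4 : ℝ)) y := rfl
  rw [e]
  exact hb y

/-- **Atoms.** The polynomial bounds of the stub lifted to the common majorant
`A(y) = (|K| + 1)(1 + |y|)ᴺ⁺¹`, which also dominates `1` and `|y|`. [folklore] -/
theorem weightedDivCurl_atoms
    (hK : ∀ y, ‖U y‖ ≤ K * (1 + ‖y‖) ^ N ∧ ‖fderiv ℝ U y‖ ≤ K * (1 + ‖y‖) ^ N)
    (y : EuclideanSpace ℝ (Fin 3)) :
    1 ≤ (|K| + 1) * (1 + ‖y‖) ^ (N + 1) ∧ ‖y‖ ≤ (|K| + 1) * (1 + ‖y‖) ^ (N + 1) ∧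
      ‖U y‖ ≤ (|K| + 1) * (1 + ‖y‖) ^ (N + 1) ∧
      ‖fderiv ℝ U y‖ ≤ (|K| + 1) * (1 + ‖y‖) ^ (N + 1) := by
  -- adapted from `gaussEnstrophy_atoms` (N10 helpers)
  obtain ⟨h1, h2⟩ := hK y
  have hρ : (1 : ℝ) ≤ 1 + ‖y‖ := le_add_of_nonneg_right (norm_nonneg _)
  have hρN : (1 + ‖y‖) ^ N ≤ (1 + ‖y‖) ^ (N + 1) := pow_le_pow_right₀ hρ N.le_succ
  have hρ1 : (1 + ‖y‖) ≤ (1 + ‖y‖) ^ (N + 1) := le_self_pow₀ hρ (Nat.succ_ne_zero N)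
  have hK1 : (1 : ℝ) ≤ |K| + 1 := by linarith [abs_nonneg K]
  have hlift : K * (1 + ‖y‖) ^ N ≤ (|K| + 1) * (1 + ‖y‖) ^ (N + 1) :=
    calc K * (1 + ‖y‖) ^ N ≤ (|K| + 1) * (1 + ‖y‖) ^ N :=
          mul_le_mul_of_nonneg_right (by linarith [le_abs_self K]) (by positivity)
      _ ≤ (|K| + 1) * (1 + ‖y‖) ^ (N + 1) := mul_le_mul_of_nonneg_left hρN (by positivity)
  refine ⟨?_, ?_, h1.trans hlift, h2.trans hlift⟩
  · calc (1 : ℝ) ≤ (1 + ‖y‖) ^ (N + 1) := one_le_pow₀ hρ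
      _ ≤ (|K| + 1) * (1 + ‖y‖) ^ (N + 1) := le_mul_of_one_le_left (by positivity) hK1
  · calc ‖y‖ ≤ 1 + ‖y‖ := by linarith
      _ ≤ (1 + ‖y‖) ^ (N + 1) := hρ1
      _ ≤ (|K| + 1) * (1 + ‖y‖) ^ (N + 1) := le_mul_of_one_le_left (by positivity) hK1

/-- **Pointwise bounds** of the seven integrands (`w₀|DU|²_F`, `w₀|curl U|²`, `w₀ (U·∇)U`,
`(y·U) w₀ U`, `w₀ (y·U)²`, `w₀ |U|²`, `w₀ ⟪y, DU[U]⟫`) by the integrable majorant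
`(|K| + 1)⁴ (1 + |y|)^{4(N+1)} w₀`, up to the constants `3`, `‖curlCLM‖²`, `1`
(`|DU|²_F ≤ 3‖DU‖²` is `ParabolicBump.frobeniusNormSq_le_three_mul_norm_sq'`,
`|curl U| ≤ ‖curlCLM‖ ‖DU‖` is `norm_curl_le`). [folklore] -/
theorem weightedDivCurl_bounds
    (hK : ∀ y, ‖U y‖ ≤ K * (1 + ‖y‖) ^ N ∧ ‖fderiv ℝ U y‖ ≤ K * (1 + ‖y‖) ^ N)
    (y : EuclideanSpace ℝ (Fin 3)) :
    |gaussProfile (-(1 / 4 : ℝ)) y * frobeniusNormSq (fderiv ℝ U y)| ≤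
        (3 * (|K| + 1) ^ 4) * ((1 + ‖y‖) ^ (4 * (N + 1)) * gaussProfile (-(1 / 4 : ℝ)) y) ∧
      |gaussProfile (-(1 / 4 : ℝ)) y * ‖curl U y‖ ^ 2| ≤
        (‖curlCLM‖ ^ 2 * (|K| + 1) ^ 4) *
          ((1 + ‖y‖) ^ (4 * (N + 1)) * gaussProfile (-(1 / 4 : ℝ)) y) ∧
      ‖gaussProfile (-(1 / 4 : ℝ)) y • convect U U y‖ ≤
        (1 * (|K| + 1) ^ 4) * ((1 + ‖y‖) ^ (4 * (N + 1)) * gaussProfile (-(1 / 4 : ℝ)) y) ∧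
      ‖⟪y, U y⟫ • (gaussProfile (-(1 / 4 : ℝ)) y • U y)‖ ≤
        (1 * (|K| + 1) ^ 4) * ((1 + ‖y‖) ^ (4 * (N + 1)) * gaussProfile (-(1 / 4 : ℝ)) y) ∧
      |gaussProfile (-(1 / 4 : ℝ)) y * ⟪y, U y⟫ ^ 2| ≤
        (1 * (|K| + 1) ^ 4) * ((1 + ‖y‖) ^ (4 * (N + 1)) * gaussProfile (-(1 / 4 : ℝ)) y) ∧
      |gaussProfile (-(1 / 4 : ℝ)) y * ‖U y‖ ^ 2| ≤
        (1 * (|K| + 1) ^ 4) * ((1 + ‖y‖) ^ (4 * (N + 1)) * gaussProfile (-(1 / 4 : ℝ)) y) ∧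
      |gaussProfile (-(1 / 4 : ℝ)) y * ⟪y, fderiv ℝ U y (U y)⟫| ≤
        (1 * (|K| + 1) ^ 4) * ((1 + ‖y‖) ^ (4 * (N + 1)) * gaussProfile (-(1 / 4 : ℝ)) y) := by
  obtain ⟨h1, hy, hUy, hDU⟩ := weightedDivCurl_atoms hK y
  set A : ℝ := (|K| + 1) * (1 + ‖y‖) ^ (N + 1) with hA_def
  have hA0 : 0 ≤ A := zero_le_one.trans h1
  have hA24 : A ^ 2 ≤ A ^ 4 := pow_le_pow_right₀ h1 (by norm_num)
  have hA34 : A ^ 3 ≤ A ^ 4 := pow_le_pow_right₀ h1 (by norm_num)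
  have hg0 : 0 < gaussProfile (-(1 / 4 : ℝ)) y := Real.exp_pos _
  have hM : ∀ c : ℝ,
      (c * (|K| + 1) ^ 4) * ((1 + ‖y‖) ^ (4 * (N + 1)) * gaussProfile (-(1 / 4 : ℝ)) y) =
        c * A ^ 4 * gaussProfile (-(1 / 4 : ℝ)) y := by
    intro c
    rw [hA_def, mul_pow, mul_comm 4 (N + 1), pow_mul]
    ring
  rw [hM, hM, hM]
  -- products of atoms
  have hDUU : ‖fderiv ℝ U y (U y)‖ ≤ A ^ 2 :=
    calc ‖fderiv ℝ U y (U y)‖ ≤ ‖fderiv ℝ U y‖ * ‖U y‖ := ContinuousLinearMap.le_opNorm _ _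
      _ ≤ A * A := mul_le_mul hDU hUy (norm_nonneg _) hA0
      _ = A ^ 2 := by ring
  have hθ : |⟪y, U y⟫| ≤ A ^ 2 :=
    (abs_real_inner_le_norm _ _).trans (by rw [sq]; exact mul_le_mul hy hUy (norm_nonneg _) hA0)
  have hyDUU : |⟪y, fderiv ℝ U y (U y)⟫| ≤ A ^ 3 :=
    (abs_real_inner_le_norm _ _).trans
      (calc ‖y‖ * ‖fderiv ℝ U y (U y)‖ ≤ A * A ^ 2 := mul_le_mul hy hDUU (norm_nonneg _) hA0
        _ = A ^ 3 := by ring)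
  have hU2 : ‖U y‖ ^ 2 ≤ A ^ 2 := pow_le_pow_left₀ (norm_nonneg _) hUy 2
  have hDU2 : ‖fderiv ℝ U y‖ ^ 2 ≤ A ^ 2 := pow_le_pow_left₀ (norm_nonneg _) hDU 2
  refine ⟨?_, ?_, ?_, ?_, ?_, ?_, ?_⟩
  · rw [abs_of_nonneg (mul_nonneg hg0.le (frobeniusNormSq_nonneg _))]
    have hF : frobeniusNormSq (fderiv ℝ U y) ≤ 3 * A ^ 4 :=
      calc frobeniusNormSq (fderiv ℝ U y) ≤ 3 * ‖fderiv ℝ U y‖ ^ 2 :=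
            ParabolicBump.frobeniusNormSq_le_three_mul_norm_sq' _
        _ ≤ 3 * A ^ 4 := by linarith
    calc gaussProfile (-(1 / 4 : ℝ)) y * frobeniusNormSq (fderiv ℝ U y)
        ≤ gaussProfile (-(1 / 4 : ℝ)) y * (3 * A ^ 4) := mul_le_mul_of_nonneg_left hF hg0.le
      _ = 3 * A ^ 4 * gaussProfile (-(1 / 4 : ℝ)) y := by ring
  · rw [abs_of_nonneg (by positivity)]
    have hcurl : ‖curl U y‖ ^ 2 ≤ ‖curlCLM‖ ^ 2 * A ^ 4 :=
      calc ‖curl U y‖ ^ 2 ≤ (‖curlCLM‖ * ‖fderiv ℝ U y‖) ^ 2 :=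
            pow_le_pow_left₀ (norm_nonneg _) (norm_curl_le U y) 2
        _ = ‖curlCLM‖ ^ 2 * ‖fderiv ℝ U y‖ ^ 2 := by ring
        _ ≤ ‖curlCLM‖ ^ 2 * A ^ 4 :=
            mul_le_mul_of_nonneg_left (hDU2.trans hA24) (by positivity)
    calc gaussProfile (-(1 / 4 : ℝ)) y * ‖curl U y‖ ^ 2
        ≤ gaussProfile (-(1 / 4 : ℝ)) y * (‖curlCLM‖ ^ 2 * A ^ 4) :=
          mul_le_mul_of_nonneg_left hcurl hg0.le
      _ = ‖curlCLM‖ ^ 2 * A ^ 4 * gaussProfile (-(1 / 4 : ℝ)) y := by ring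
  · rw [norm_smul, Real.norm_of_nonneg hg0.le, convect_apply]
    calc gaussProfile (-(1 / 4 : ℝ)) y * ‖fderiv ℝ U y (U y)‖
        ≤ gaussProfile (-(1 / 4 : ℝ)) y * A ^ 4 :=
          mul_le_mul_of_nonneg_left (hDUU.trans hA24) hg0.le
      _ = 1 * A ^ 4 * gaussProfile (-(1 / 4 : ℝ)) y := by ring
  · rw [norm_smul, norm_smul, Real.norm_of_nonneg hg0.le, Real.norm_eq_abs]
    calc |⟪y, U y⟫| * (gaussProfile (-(1 / 4 : ℝ)) y * ‖U y‖)
        ≤ A ^ 2 * (gaussProfile (-(1 / 4 : ℝ)) y * A) :=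
          mul_le_mul hθ (mul_le_mul_of_nonneg_left hUy hg0.le) (by positivity) (by positivity)
      _ = A ^ 3 * gaussProfile (-(1 / 4 : ℝ)) y := by ring
      _ ≤ 1 * A ^ 4 * gaussProfile (-(1 / 4 : ℝ)) y := by
          rw [one_mul]; exact mul_le_mul_of_nonneg_right hA34 hg0.le
  · rw [abs_of_nonneg (by positivity)]
    have hθ2 : ⟪y, U y⟫ ^ 2 ≤ A ^ 4 :=
      calc ⟪y, U y⟫ ^ 2 = |⟪y, U y⟫| ^ 2 := (sq_abs _).symm
        _ ≤ (A ^ 2) ^ 2 := pow_le_pow_left₀ (abs_nonneg _) hθ 2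
        _ = A ^ 4 := by ring
    calc gaussProfile (-(1 / 4 : ℝ)) y * ⟪y, U y⟫ ^ 2 ≤ gaussProfile (-(1 / 4 : ℝ)) y * A ^ 4 :=
          mul_le_mul_of_nonneg_left hθ2 hg0.le
      _ = 1 * A ^ 4 * gaussProfile (-(1 / 4 : ℝ)) y := by ring
  · rw [abs_of_nonneg (by positivity)]
    calc gaussProfile (-(1 / 4 : ℝ)) y * ‖U y‖ ^ 2 ≤ gaussProfile (-(1 / 4 : ℝ)) y * A ^ 4 :=
          mul_le_mul_of_nonneg_left (hU2.trans hA24) hg0.le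
      _ = 1 * A ^ 4 * gaussProfile (-(1 / 4 : ℝ)) y := by ring
  · rw [abs_mul, abs_of_pos hg0]
    calc gaussProfile (-(1 / 4 : ℝ)) y * |⟪y, fderiv ℝ U y (U y)⟫|
        ≤ gaussProfile (-(1 / 4 : ℝ)) y * A ^ 4 :=
          mul_le_mul_of_nonneg_left (hyDUU.trans hA34) hg0.le
      _ = 1 * A ^ 4 * gaussProfile (-(1 / 4 : ℝ)) y := by ring

/-! ### The registered stub -/

/-- **Stub N22 — the kinematic weighted div–curl identity.** For a divergence-free `C²` field
`U : ℝ³ → ℝ³` with `|U|, ‖DU‖ ≤ K (1 + |y|)ᴺ` and the Gaussian weight `w₀ = e^{−|y|²/4}`,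
`∫ w₀ |DU|²_F − ∫ w₀ |curl U|² = ¼ ∫ w₀ (y·U)² − ½ ∫ w₀ |U|²`.
Proof: pointwise `|DU|²_F − |curl U|² = div((U·∇)U)` (`weightedDivCurl_pointwise`); then two
whole-space integrations by parts against the Gaussian
(`integral_mul_divergence_add_eq_zero_of_integrable`, `∇w₀ = −½ w₀ y`):
`∫ w₀ div((U·∇)U) = ½ ∫ w₀ ⟪y, DU[U]⟫` and
`∫ w₀ ⟪y, DU[U]⟫ = ½ ∫ w₀ (y·U)² − ∫ w₀ |U|²` (from `div(w₀ U) = −½ w₀ (y·U)`,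
`⟪w₀ U, ∇(y·U)⟫ = w₀(|U|² + ⟪y, DU[U]⟫)`), all integrands being `O((1 + |y|)^{4N+4} w₀)`
(`weightedDivCurl_bounds`). For the crux this makes the energy form of the Gaussian enstrophy
identity N10 available on every slice of the Leray orbit. [folklore] -/
theorem stub_weightedDivCurl :
    ∀ U : EuclideanSpace ℝ (Fin 3) → EuclideanSpace ℝ (Fin 3), ContDiff ℝ 2 U → VectorCalculus.IsDivFree U →
      (∃ K : ℝ, ∃ N : ℕ, ∀ y, ‖U y‖ ≤ K * (1 + ‖y‖) ^ N ∧ ‖fderiv ℝ U y‖ ≤ K * (1 + ‖y‖) ^ N) →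
      (∫ y, Real.exp (-‖y‖ ^ 2 / 4) * frobeniusNormSq (fderiv ℝ U y)) -
          ∫ y, Real.exp (-‖y‖ ^ 2 / 4) * ‖curl U y‖ ^ 2 =
        (1 / 4 : ℝ) * (∫ y, Real.exp (-‖y‖ ^ 2 / 4) * ⟪y, U y⟫_ℝ ^ 2) -
          (1 / 2 : ℝ) * ∫ y, Real.exp (-‖y‖ ^ 2 / 4) * ‖U y‖ ^ 2 := by
  intro U hU hdiv hbd
  obtain ⟨K, N, hK⟩ := hbd
  -- the weight is the tree's `gaussProfile (−1/4)`
  have hw0 : ∀ y : EuclideanSpace ℝ (Fin 3),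
      Real.exp (-‖y‖ ^ 2 / 4) = gaussProfile (-(1 / 4 : ℝ)) y := fun y => by
    simp only [gaussProfile]
    congr 1
    ring
  simp only [hw0]
  -- regularity
  have hU1 : ContDiff ℝ 1 U := hU.of_le (by norm_num)
  have hUd : Differentiable ℝ U := hU1.differentiable one_ne_zero
  have hUc : Continuous U := hU.continuous
  have hDUc : Continuous (fderiv ℝ U) := hU.continuous_fderiv (by norm_num)
  have hg1 : ContDiff ℝ 1 (gaussProfile (E := EuclideanSpace ℝ (Fin 3)) (-(1 / 4 : ℝ))) :=
    contDiff_gaussProfile _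
  have hgc : Continuous (gaussProfile (E := EuclideanSpace ℝ (Fin 3)) (-(1 / 4 : ℝ))) :=
    hg1.continuous
  have hconv1 : ContDiff ℝ 1 (convect U U) := (hU.fderiv_right (m := 1) le_rfl).clm_apply hU1
  have hθ1 : ContDiff ℝ 1 fun z : EuclideanSpace ℝ (Fin 3) => ⟪z, U z⟫ := contDiff_id.inner ℝ hU1
  have hwU1 : ContDiff ℝ 1 fun z => gaussProfile (-(1 / 4 : ℝ)) z • U z := hg1.smul hU1
  -- continuity of the integrands
  have cF : Continuous fun y => gaussProfile (-(1 / 4 : ℝ)) y * frobeniusNormSq (fderiv ℝ U y) := by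
    refine hgc.mul ?_
    unfold frobeniusNormSq
    exact continuous_finsetSum _ fun i _ => ((hDUc.clm_apply continuous_const).norm.pow 2)
  have cΩ : Continuous fun y => gaussProfile (-(1 / 4 : ℝ)) y * ‖curl U y‖ ^ 2 :=
    hgc.mul ((continuous_curl hU1).norm.pow 2)
  have cC : Continuous fun y => gaussProfile (-(1 / 4 : ℝ)) y • convect U U y :=
    hgc.smul (hDUc.clm_apply hUc)
  have cθ : Continuous fun y : EuclideanSpace ℝ (Fin 3) => ⟪y, U y⟫ := continuous_id.inner hUc
  have cwU : Continuous fun y => gaussProfile (-(1 / 4 : ℝ)) y • U y := hgc.smul hUc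
  have cT : Continuous fun y => ⟪y, U y⟫ • (gaussProfile (-(1 / 4 : ℝ)) y • U y) := cθ.smul cwU
  have cθ2 : Continuous fun y => gaussProfile (-(1 / 4 : ℝ)) y * ⟪y, U y⟫ ^ 2 :=
    hgc.mul (cθ.pow 2)
  have cU2 : Continuous fun y => gaussProfile (-(1 / 4 : ℝ)) y * ‖U y‖ ^ 2 :=
    hgc.mul (hUc.norm.pow 2)
  have cY : Continuous fun y => gaussProfile (-(1 / 4 : ℝ)) y * ⟪y, fderiv ℝ U y (U y)⟫ :=
    hgc.mul (continuous_id.inner (hDUc.clm_apply hUc))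
  -- integrability from the pointwise bounds
  have iF : Integrable fun y => gaussProfile (-(1 / 4 : ℝ)) y * frobeniusNormSq (fderiv ℝ U y) :=
    gaussEnstrophy_integrable_of_le cF fun y => (weightedDivCurl_bounds hK y).1
  have iΩ : Integrable fun y => gaussProfile (-(1 / 4 : ℝ)) y * ‖curl U y‖ ^ 2 :=
    gaussEnstrophy_integrable_of_le cΩ fun y => (weightedDivCurl_bounds hK y).2.1
  have iC : Integrable fun y => gaussProfile (-(1 / 4 : ℝ)) y • convect U U y :=
    weightedDivCurl_integrable_vec_of_le cC fun y => (weightedDivCurl_bounds hK y).2.2.1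
  have iT : Integrable fun y => ⟪y, U y⟫ • (gaussProfile (-(1 / 4 : ℝ)) y • U y) :=
    weightedDivCurl_integrable_vec_of_le cT fun y => (weightedDivCurl_bounds hK y).2.2.2.1
  have iθ2 : Integrable fun y => gaussProfile (-(1 / 4 : ℝ)) y * ⟪y, U y⟫ ^ 2 :=
    gaussEnstrophy_integrable_of_le cθ2 fun y => (weightedDivCurl_bounds hK y).2.2.2.2.1
  have iU2 : Integrable fun y => gaussProfile (-(1 / 4 : ℝ)) y * ‖U y‖ ^ 2 :=
    gaussEnstrophy_integrable_of_le cU2 fun y => (weightedDivCurl_bounds hK y).2.2.2.2.2.1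
  have iY : Integrable fun y => gaussProfile (-(1 / 4 : ℝ)) y * ⟪y, fderiv ℝ U y (U y)⟫ :=
    gaussEnstrophy_integrable_of_le cY fun y => (weightedDivCurl_bounds hK y).2.2.2.2.2.2
  -- pointwise forms of the four integration-by-parts integrands
  have e1 : (fun y => gaussProfile (-(1 / 4 : ℝ)) y * VectorCalculus.divergence (convect U U) y) =
      fun y => gaussProfile (-(1 / 4 : ℝ)) y * frobeniusNormSq (fderiv ℝ U y) -
        gaussProfile (-(1 / 4 : ℝ)) y * ‖curl U y‖ ^ 2 := by
    funext y
    rw [← weightedDivCurl_pointwise hU hdiv y]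
    ring
  have e2 : (fun y => ⟪convect U U y, gradient (gaussProfile (-(1 / 4 : ℝ))) y⟫) =
      fun y => -(1 / 2 : ℝ) * (gaussProfile (-(1 / 4 : ℝ)) y * ⟪y, fderiv ℝ U y (U y)⟫) := by
    funext y
    rw [weightedDivCurl_inner_gradient_weight, convect_apply]
  have e3 : (fun y => ⟪y, U y⟫ *
      VectorCalculus.divergence (fun z => gaussProfile (-(1 / 4 : ℝ)) z • U z) y) =
      fun y => -(1 / 2 : ℝ) * (gaussProfile (-(1 / 4 : ℝ)) y * ⟪y, U y⟫ ^ 2) := by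
    funext y
    rw [weightedDivCurl_divergence_weight_smul (hUd y) (hdiv y)]
    ring
  have e4 : (fun y => ⟪gaussProfile (-(1 / 4 : ℝ)) y • U y, gradient (fun z => ⟪z, U z⟫) y⟫) =
      fun y => gaussProfile (-(1 / 4 : ℝ)) y * ‖U y‖ ^ 2 +
        gaussProfile (-(1 / 4 : ℝ)) y * ⟪y, fderiv ℝ U y (U y)⟫ :=
    funext fun y => weightedDivCurl_inner_gradient_theta (hUd y)
  -- the two integrations by parts on the whole space
  have h1 := integral_mul_divergence_add_eq_zero_of_integrable hg1 hconv1 iC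
    (by rw [e1]; exact iF.sub iΩ) (by rw [e2]; exact iY.const_mul _)
  have h2 := integral_mul_divergence_add_eq_zero_of_integrable hθ1 hwU1 iT
    (by rw [e3]; exact iθ2.const_mul _) (by rw [e4]; exact iU2.add iY)
  rw [e1, e2, integral_sub iF iΩ, integral_const_mul] at h1
  rw [e3, e4, integral_add iU2 iY, integral_const_mul] at h2
  linarith

end Summit.NavierStokesRegularity.NavierStokesRegularity.Theorems.PolyhedralDssProfileExists.PolyhedralCell

end
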